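import Summits.Ventures.PercRepro.PerFlatHall
import Summits.Ventures.PercRepro.OrbitK

/-!
# PercRepro — the Hall form of C-025 (C-029) at `q = 1` on every simple matroid (night-4, gen 2)

At `q = 1` the rank-`1` flats of a simple matroid are its points, the bottom sets are the singletons `{e}` whose
complement spans, and every set `S` with `2 ≤ |S| ≤ p − 1` lies in the middle level and is adjacent to each of its
points.  For a family `𝒢` of `k` points the middle sets meeting `𝒢` number at least `k · C(n, j)/n` at each size
`j` (double-count the incidences `(S, e)`, `e ∈ S ∩ 𝒢`: `k · C(n − 1, j − 1) = k · j · C(n, j)/n`, and each `S`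
carries at most `j` of them), and `C(n, j)/n ≥ C(p + 1, j)/(p + 1)` for `n ≥ p + 1`; summing over
`2 ≤ j ≤ p − 1` gives `Φ(p, 1) · k = k · Σ_j C(p + 1, j)/(p + 1)`.  Hence

**`hall_q_one`**: `Hall M p 1 (Φ(p, 1))` for every simple matroid `M` and every `p ≥ 2` — C-029 at `q = 1`, the
Hall-form analogue of Theorem B (the `q = 1` row of C-025), proved directly (no per-flat certificate of the tree is
used).  Imports `PerFlatHall` and `OrbitK` (for `phiK`).
-/

namespace PercRepro.PerFlat

open Finset ThmH

variable {α : Type*} [DecidableEq α] {M : Matroid α} [M.Finite]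

/-! ## Points of a simple matroid -/

/-- A set of rank `1` in a simple matroid is a singleton. -/
theorem eq_singleton_of_eRk_one (hs : Simple M) {B : Finset α} (hB : B ⊆ gr M)
    (hr : M.eRk (B : Set α) = 1) : ∃ e ∈ B, B = {e} := by
  obtain ⟨e, he⟩ : B.Nonempty := by
    by_contra h
    rw [Finset.not_nonempty_iff_eq_empty] at h
    rw [h, Finset.coe_empty, M.eRk_empty] at hr
    exact zero_ne_one hr
  refine ⟨e, he, ?_⟩
  ext f
  refine ⟨fun hf => ?_, fun hf => by rw [Finset.mem_singleton] at hf; rw [hf]; exact he⟩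
  rw [Finset.mem_singleton]
  by_contra hne
  have heE : e ∈ M.E := by rw [← coe_gr]; exact_mod_cast hB he
  have hfE : f ∈ M.E := by rw [← coe_gr]; exact_mod_cast hB hf
  have h2 := hs e heE f hfE (Ne.symm hne)
  have hsub : (({e, f} : Finset α) : Set α) ⊆ (B : Set α) := by
    rw [Finset.coe_pair]
    exact Set.insert_subset (Finset.mem_coe.2 he) (Set.singleton_subset_iff.2 (Finset.mem_coe.2 hf))
  have := M.eRk_mono hsub
  rw [Finset.coe_pair, h2, hr] at this
  exact absurd this (by decide)

omit [DecidableEq α] in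
/-- A point of a simple matroid with a second point has rank `1`. -/
theorem eRk_singleton_eq_one (hs : Simple M) {e f : α} (he : e ∈ gr M) (hf : f ∈ gr M) (hne : e ≠ f) :
    M.eRk ({e} : Set α) = 1 := by
  have heE : e ∈ M.E := by rw [← coe_gr]; exact_mod_cast he
  have hfE : f ∈ M.E := by rw [← coe_gr]; exact_mod_cast hf
  have h2 := hs e heE f hfE hne
  have h1 := M.eRk_insert_le_add_one f ({e} : Set α)
  rw [show (insert f ({e} : Set α)) = {e, f} from Set.pair_comm f e, h2] at h1
  have h3 : M.eRk ({e} : Set α) ≤ 1 := by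
    have := M.eRk_le_encard ({e} : Set α)
    rwa [Set.encard_singleton] at this
  obtain ⟨k, hk, -⟩ := eRk_eq_nat M ({e} : Finset α)
  rw [Finset.coe_singleton] at hk
  rw [hk] at h1 h3 ⊢
  have h1' : 2 ≤ k + 1 := by exact_mod_cast h1
  have h3' : k ≤ 1 := by exact_mod_cast h3
  have : k = 1 := by omega
  rw [this]
  rfl

/-- The closure of a point of a simple matroid is the point. -/
theorem clF_singleton (hs : Simple M) {e : α} (he : e ∈ gr M) : clF M {e} = {e} := by
  ext f
  rw [← Finset.mem_coe, coe_clF, Finset.coe_singleton, Finset.mem_singleton]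
  constructor
  · intro hf
    by_contra hne
    have hfE : f ∈ M.E := M.closure_subset_ground _ hf
    have heE : e ∈ M.E := by rw [← coe_gr]; exact_mod_cast he
    have h2 := hs e heE f hfE (Ne.symm hne)
    have h1 : M.eRk (insert f ({e} : Set α)) = M.eRk ({e} : Set α) := by
      rw [← M.eRk_closure_eq (insert f _), Matroid.closure_insert_eq_of_mem_closure hf, M.eRk_closure_eq]
    rw [show (insert f ({e} : Set α)) = {e, f} from Set.pair_comm f e, h2] at h1
    have hfg : f ∈ gr M := by rw [← Finset.mem_coe, coe_gr]; exact hfE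
    rw [eRk_singleton_eq_one hs he hfg (Ne.symm hne)] at h1
    exact absurd h1 (by decide)
  · rintro rfl
    exact M.subset_closure _ (by rw [Set.singleton_subset_iff, ← coe_gr]; exact_mod_cast he) rfl

/-! ## The counting: the `j`-sets meeting a `k`-set -/

omit [M.Finite] in
/-- The incidences `(S, e)` with `S` a `j`-subset of `t` and `e ∈ S ∩ P`: `Σ_S #(S ∩ P) = #P · C(#t − 1, j − 1)`. -/
theorem sum_card_inter_powersetCard (t P : Finset α) (hP : P ⊆ t) {j : ℕ} (hj : 1 ≤ j) :
    ∑ S ∈ t.powersetCard j, (S ∩ P).card = P.card * (t.card - 1).choose (j - 1) := by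
  have h1 : ∀ S : Finset α, (S ∩ P).card = ∑ e ∈ P, (if e ∈ S then 1 else 0) := by
    intro S
    rw [← Finset.card_filter, Finset.filter_mem_eq_inter, Finset.inter_comm]
  simp_rw [h1]
  rw [Finset.sum_comm]
  have h2 : ∀ e ∈ P, ∑ S ∈ t.powersetCard j, (if e ∈ S then 1 else 0) = (t.card - 1).choose (j - 1) := by
    intro e he
    rw [← Finset.card_filter]
    have hsub : ({e} : Finset α) ⊆ t := Finset.singleton_subset_iff.2 (hP he)
    have := Finset.card_filter_powersetCard_subset {e} t j hsub (by rw [Finset.card_singleton]; exact hj)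
    rw [Finset.card_singleton] at this
    rw [← this]
    congr 1
    apply Finset.filter_congr
    intro S _
    rw [Finset.singleton_subset_iff]
  rw [Finset.sum_congr rfl h2, Finset.sum_const, smul_eq_mul]

omit [M.Finite] in
/-- `#P · C(#t − 1, j − 1) ≤ j · #{S ∈ powersetCard j t : S ∩ P ≠ ∅}`: each incidence `(S, e)` lies on a set
meeting `P`, and a `j`-set carries at most `j` incidences. -/
theorem card_meets_mul_ge (t P : Finset α) (hP : P ⊆ t) {j : ℕ} (hj : 1 ≤ j) :
    P.card * (t.card - 1).choose (j - 1) ≤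
      j * ((t.powersetCard j).filter (fun S => (S ∩ P).Nonempty)).card := by
  rw [← sum_card_inter_powersetCard t P hP hj,
    ← Finset.sum_filter_add_sum_filter_not (t.powersetCard j) (fun S => (S ∩ P).Nonempty)]
  have h0 : ∑ S ∈ (t.powersetCard j).filter (fun S => ¬ (S ∩ P).Nonempty), (S ∩ P).card = 0 := by
    apply Finset.sum_eq_zero
    intro S hS
    rw [Finset.mem_filter, Finset.not_nonempty_iff_eq_empty] at hS
    rw [hS.2, Finset.card_empty]
  rw [h0, add_zero]
  calc ∑ S ∈ (t.powersetCard j).filter (fun S => (S ∩ P).Nonempty), (S ∩ P).card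
      ≤ ∑ S ∈ (t.powersetCard j).filter (fun S => (S ∩ P).Nonempty), j := by
        apply Finset.sum_le_sum
        intro S hS
        rw [Finset.mem_filter, Finset.mem_powersetCard] at hS
        rw [← hS.1.2]
        exact Finset.card_le_card Finset.inter_subset_left
    _ = j * ((t.powersetCard j).filter (fun S => (S ∩ P).Nonempty)).card := by
        rw [Finset.sum_const, smul_eq_mul, mul_comm]

/-- `#P · C(p + 1, j) ≤ (p + 1) · #{S ∈ powersetCard j t : S ∩ P ≠ ∅}` for `#t ≥ p + 1`, `1 ≤ j`. -/
theorem card_meets_mul_ge' (t P : Finset α) (hP : P ⊆ t) {j p : ℕ} (hj : 1 ≤ j) (ht : p + 1 ≤ t.card) :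
    P.card * (p + 1).choose j ≤ (p + 1) * ((t.powersetCard j).filter (fun S => (S ∩ P).Nonempty)).card := by
  have h1 := card_meets_mul_ge t P hP hj
  have h2 : p.choose (j - 1) ≤ (t.card - 1).choose (j - 1) := Nat.choose_le_choose _ (by omega)
  have h3 : (p + 1) * p.choose (j - 1) = (p + 1).choose j * j := by
    have := Nat.add_one_mul_choose_eq p (j - 1)
    rw [show j - 1 + 1 = j by omega] at this
    exact this
  have h4 : P.card * ((p + 1).choose j * j) ≤
      (p + 1) * (j * ((t.powersetCard j).filter (fun S => (S ∩ P).Nonempty)).card) := by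
    calc P.card * ((p + 1).choose j * j) = (p + 1) * (P.card * p.choose (j - 1)) := by rw [← h3]; ring
      _ ≤ (p + 1) * (P.card * (t.card - 1).choose (j - 1)) := by gcongr
      _ ≤ (p + 1) * (j * ((t.powersetCard j).filter (fun S => (S ∩ P).Nonempty)).card) := by gcongr
  have hj0 : 0 < j := hj
  nlinarith [h4]

/-! ## C-029 at `q = 1` -/

/-- The points of a family of rank-`1` flats. -/
noncomputable def pointsOf (M : Matroid α) [M.Finite] (𝒢 : Finset (Finset α)) : Finset α :=
  (gr M).filter (fun e => ({e} : Finset α) ∈ 𝒢)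

/-- `UqFam M p 1 𝒢` has at most `#pointsOf 𝒢` elements (simple matroid). -/
theorem card_UqFam_one_le (hs : Simple M) {p : ℕ} (𝒢 : Finset (Finset α)) :
    (UqFam M p 1 𝒢).card ≤ (pointsOf M 𝒢).card := by
  refine (Finset.card_le_card ?_).trans (Finset.card_image_le (f := fun e : α => ({e} : Finset α)))
  intro B hB
  rw [mem_UqFam] at hB
  obtain ⟨hBU, hcl⟩ := hB
  have hBU' := mem_Uq.1 hBU
  obtain ⟨e, heB, rfl⟩ := eq_singleton_of_eRk_one hs hBU'.1 (by rw [hBU'.2.1]; rfl)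
  have he : e ∈ gr M := hBU'.1 heB
  rw [clF_singleton hs he] at hcl
  rw [Finset.mem_image]
  exact ⟨e, by unfold pointsOf; rw [Finset.mem_filter]; exact ⟨he, hcl⟩, rfl⟩

/-- The `j`-sets meeting the points of `𝒢`, `2 ≤ j ≤ p − 1`, are middle sets adjacent to a flat of `𝒢`. -/
theorem meets_subset_nbhd (hs : Simple M) {p : ℕ} (𝒢 : Finset (Finset α)) {j : ℕ} (hj : j ∈ Finset.Ioo 1 p) :
    ((gr M).powersetCard j).filter (fun S => (S ∩ pointsOf M 𝒢).Nonempty) ⊆ nbhd M p 1 𝒢 := by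
  intro S hS
  rw [Finset.mem_filter, Finset.mem_powersetCard] at hS
  obtain ⟨⟨hSg, hScard⟩, e, he⟩ := hS
  rw [Finset.mem_inter] at he
  obtain ⟨heS, heP⟩ := he
  unfold pointsOf at heP
  rw [Finset.mem_filter] at heP
  rw [Finset.mem_Ioo] at hj
  -- a second point of `S`
  obtain ⟨f, hfS, hfe⟩ := Finset.exists_mem_ne (by omega : 1 < S.card) e
  have hf : f ∈ gr M := hSg hfS
  have heE : e ∈ M.E := by rw [← coe_gr]; exact_mod_cast heP.1
  have hfE : f ∈ M.E := by rw [← coe_gr]; exact_mod_cast hf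
  have h2 := hs e heE f hfE (Ne.symm hfe)
  rw [mem_nbhd]
  refine ⟨?_, {e}, heP.2, ?_⟩
  · unfold Yq
    rw [Finset.mem_filter, Finset.mem_powerset]
    refine ⟨hSg, ?_, ?_⟩
    · have hsub : (({e, f} : Finset α) : Set α) ⊆ (S : Set α) := by
        rw [Finset.coe_pair]
        exact Set.insert_subset (Finset.mem_coe.2 heS) (Set.singleton_subset_iff.2 (Finset.mem_coe.2 hfS))
      have := M.eRk_mono hsub
      rw [Finset.coe_pair, h2] at this
      exact lt_of_lt_of_le (by decide) this
    · have := M.eRk_le_encard (S : Set α)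
      rw [Set.encard_coe_eq_coe_finsetCard, hScard] at this
      exact lt_of_le_of_lt this (by exact_mod_cast hj.2)
  · unfold Adj
    rw [Finset.inter_singleton_of_mem heS, Finset.coe_singleton]
    exact eRk_singleton_eq_one hs heP.1 hf (Ne.symm hfe)

/-- `Φ(p, 1) = (Σ_{u ∈ Ioo 1 p} C(p + 1, u)) / (p + 1)`. -/
theorem phiK_one (p : ℕ) : phiK p 1 = (∑ u ∈ Finset.Ioo 1 p, ((p + 1).choose u : ℚ)) / ((p : ℚ) + 1) := by
  unfold phiK
  rw [Nat.choose_succ_self_right]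
  push_cast
  rfl

/-- **C-029 at `q = 1`**: `Hall M p 1 (Φ(p, 1))` for every simple matroid `M` and every `p`. -/
theorem hall_q_one (hs : Simple M) (p : ℕ) : Hall M p 1 (phiK p 1) := by
  intro 𝒢 h𝒢
  classical
  have hΦ : 0 ≤ phiK p 1 := by
    rw [phiK_one]
    positivity
  by_cases hU : (UqFam M p 1 𝒢).card = 0
  · rw [hU]
    simp only [Nat.cast_zero, mul_zero]
    positivity
  -- the ground set has at least `p + 1` points
  have hn : p + 1 ≤ (gr M).card := by
    obtain ⟨B, hB⟩ := Finset.card_pos.1 (Nat.pos_of_ne_zero hU)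
    have hBU := mem_Uq.1 (mem_UqFam.1 hB).1
    have h1 := M.eRk_le_encard ((gr M \ B : Finset α) : Set α)
    rw [hBU.2.2, Set.encard_coe_eq_coe_finsetCard, Finset.card_sdiff_of_subset hBU.1] at h1
    have h2 : p ≤ (gr M).card - B.card := by exact_mod_cast h1
    obtain ⟨e, -, rfl⟩ := eq_singleton_of_eRk_one hs hBU.1 (by rw [hBU.2.1]; rfl)
    rw [Finset.card_singleton] at h2
    have := Finset.card_pos.2 ⟨e, hBU.1 (Finset.mem_singleton_self e)⟩
    omega
  -- the meeting sets, by size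
  set P := pointsOf M 𝒢 with hPdef
  have hPg : P ⊆ gr M := Finset.filter_subset _ _
  set T : Finset (Finset α) := (Finset.Ioo 1 p).biUnion
    (fun j => ((gr M).powersetCard j).filter (fun S => (S ∩ P).Nonempty)) with hTdef
  have hTsub : T ⊆ nbhd M p 1 𝒢 := by
    intro S hS
    rw [hTdef, Finset.mem_biUnion] at hS
    obtain ⟨j, hj, hS⟩ := hS
    exact meets_subset_nbhd hs 𝒢 hj hS
  have hTcard : T.card = ∑ j ∈ Finset.Ioo 1 p,
      (((gr M).powersetCard j).filter (fun S => (S ∩ P).Nonempty)).card := by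
    rw [hTdef]
    apply Finset.card_biUnion
    intro i _ j _ hij
    simp only [Function.onFun]
    rw [Finset.disjoint_left]
    intro S hSi hSj
    rw [Finset.mem_filter, Finset.mem_powersetCard] at hSi hSj
    exact hij (hSi.1.2.symm.trans hSj.1.2)
  -- the per-size bound, summed
  have hsum : (∑ u ∈ Finset.Ioo 1 p, ((p + 1).choose u : ℚ)) * (P.card : ℚ) ≤
      ((p : ℚ) + 1) * (T.card : ℚ) := by
    rw [hTcard, Finset.sum_mul]
    push_cast
    rw [Finset.mul_sum]
    apply Finset.sum_le_sum
    intro j hj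
    rw [Finset.mem_Ioo] at hj
    have := card_meets_mul_ge' (gr M) P hPg (j := j) (p := p) (by omega) hn
    have h' : ((P.card * (p + 1).choose j : ℕ) : ℚ) ≤
        (((p + 1) * (((gr M).powersetCard j).filter (fun S => (S ∩ P).Nonempty)).card : ℕ) : ℚ) := by
      exact_mod_cast this
    push_cast at h'
    linarith
  have hp1 : (0 : ℚ) < (p : ℚ) + 1 := by positivity
  calc phiK p 1 * ((UqFam M p 1 𝒢).card : ℚ)
      ≤ phiK p 1 * (P.card : ℚ) := by
        apply mul_le_mul_of_nonneg_left _ hΦ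
        exact_mod_cast card_UqFam_one_le hs 𝒢
    _ = ((∑ u ∈ Finset.Ioo 1 p, ((p + 1).choose u : ℚ)) * (P.card : ℚ)) / ((p : ℚ) + 1) := by
        rw [phiK_one]
        ring
    _ ≤ (T.card : ℚ) := by
        rw [div_le_iff₀ hp1]
        linarith
    _ ≤ ((nbhd M p 1 𝒢).card : ℚ) := by exact_mod_cast Finset.card_le_card hTsub

end PercRepro.PerFlat
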